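import Summits.ValiantsHypothesis.ValiantsHypothesis.Theorems.FifoMatchingNNDivisionHardConePricingBalancedFace

/-!
# TwistedFace44 — the UNRESTRICTED corona zonotope is unbudgeted (val-idea-44 g1, W7 lane (b), T0 test of V#109)

**Theorem (`mirror_three_pow_le`).**  Let `F` be any family of disjoint pairs `(A,B)` of subsets of `[h]`, `2n+2 ≤ h`, which contains the
`2ⁿ` MIRROR PAIRS `(ρ(S), ρ′(S))`, `S = rootSet b ⊆ Fin (n+1)` (`ρ` = the block `R = {p < n+1}`, `ρ′` = the twin block `{n+1 ≤ p < 2n+2}`).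
Then every extended formulation of the corona zonotope `Z_F = Σ_{(A,B) ∈ F} [0,1]·g_{A,B}` (`g_{A,B} = 𝟙_{A∪B}𝟙_{A∪B}ᵀ − 𝟙_B𝟙_Bᵀ`) has
size `r` with `3ⁿ ≤ (r+1)·2ⁿ`.  In particular (`zCorAll_three_pow_le`) 41's canonical UNRESTRICTED corona zonotope
`Z′_cor(h) = Σ_{A ≠ ∅, A ∩ B = ∅} [0,1]·g_{A,B}` has `xc ≥ 1.5^{⌊h/2⌋−1} − 1` — it is T0-DEAD (not a budgeted passenger), which settles the question
left open by 44 g0 (`ConePricing44` §13 N13: «conjecture Z_cor FAN-CHEAP») in the NEGATIVE and removes the size-matching hypothesis of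
`balancedFace_three_pow_le` / `zCorSM_three_pow_le` entirely.

**The certificate (TWISTED TWIN FACE).**  A rank-two functional per row `a ⊆ [n]`:
`c_a = −u_a u_aᵀ + λ·v vᵀ`, where `u_a` is the BFPS vector pushed to the block `R` and `v` is the TWIN WEIGHT
`v_p = 2·8^p (p ∈ R)`, `v_{n+1+i} = −8^i (twin block)`, `v_p = 4·8^{n+1}` (outside).  On a zone,
`⟨v vᵀ, g_{A,B}⟩ = V_A (V_A + 2 V_B)` (`V_S = Σ_S v`), and a base-8 signed-digit argument (`digits8_eq_zero`) shows
`V_A (V_A + 2V_B) = 0 ⇒ A = ∅ ∨ B ∩ R = ∅` (`zone_zero_cases`); since `v` is integer valued, `|V_A(V_A+2V_B)| ≥ 1` otherwise, so with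
`λ = 2(h(n+1))² + 1` the sign of `⟨c_a, g⟩` on every other zone is the sign of `V_A(V_A+2V_B)` — INDEPENDENT of `a`.  Base point
`v₀ = Σ_{(A,B) ∈ F, V_A(V_A+2V_B) > 0} g_{A,B}`, points `v_b = v₀ + g_{ρ(rootSet b), ρ′(rootSet b)}`, right-hand sides `d_a = ⟨c_a, v₀⟩`:
validity on `Z_F` is termwise, and the slack at `v_b` is `(|a ∩ b| − 1)²` — the UDISJ pattern — so `HasEFOfSize.three_pow_le` applies.
(The mirror zones are NOT a face of the corona cone — no sign-definite functional isolates them — hence the «twist» `λ v vᵀ` of mixed sign;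
this is why apex / antitone-chamber pricing (g0's locality wall) could not see the hardness.)

Exhaustive numerical check of the certificate for `h ≤ 10`: `scripts/rank_one_twist_check.py` (0 violations).  No new axioms; kernel-checked below.
-/

noncomputable section
open Finset

namespace Summit.ValiantsHypothesis.ValiantsHypothesis.Cruxes.NNDivisionHard.TwistedFace44

open Literature.Barriers.PneNP (HasEFOfSize)
open Literature.Combinatorics.Optimization (corPolytopeGraph corVec)
open Summit.ValiantsHypothesis.ValiantsHypothesis.Theorems.FifoMatching.ConePricing

variable {h : ℕ}

/-! ## 1. Base-8 signed digits -/

/-- signed base-8 digits: `Σ_x d_x 8^x = 0` with all `|d_x| < 8` forces every digit to vanish. -/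
theorem digits8_eq_zero : ∀ (m : ℕ) (d : Fin m → ℤ), (∀ x, |d x| < 8) → ∑ x, d x * 8 ^ (x : ℕ) = 0 → ∀ x, d x = 0
  | 0, _, _, _ => fun x => x.elim0
  | m + 1, d, hd, hs => by
      rw [Fin.sum_univ_succ] at hs
      simp only [Fin.val_zero, pow_zero, mul_one, Fin.val_succ, pow_succ] at hs
      have hmul : ∑ x : Fin m, d x.succ * (8 ^ (x : ℕ) * 8) = 8 * ∑ x : Fin m, d x.succ * 8 ^ (x : ℕ) := by
        rw [Finset.mul_sum]
        exact Finset.sum_congr rfl fun x _ => by ring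
      rw [hmul] at hs
      have h0 : d 0 = 0 := by
        have hk : d 0 = 8 * (-(∑ x : Fin m, d x.succ * 8 ^ (x : ℕ))) := by linarith
        have hlt := hd 0
        rw [hk, abs_mul] at hlt
        have h8 : |(8:ℤ)| = 8 := by norm_num
        rw [h8] at hlt
        have : |(-(∑ x : Fin m, d x.succ * 8 ^ (x : ℕ)))| < 1 := by linarith [abs_nonneg (-(∑ x : Fin m, d x.succ * 8 ^ (x : ℕ)))]
        rw [Int.abs_lt_one_iff] at this
        rw [hk, this, mul_zero]
      have hs' : ∑ x : Fin m, d x.succ * 8 ^ (x : ℕ) = 0 := by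
        rw [h0] at hs
        linarith
      intro x
      refine Fin.cases h0 (fun i => ?_) x
      exact digits8_eq_zero m (fun i => d i.succ) (fun i => hd i.succ) hs' i

/-- `Σ_{i < m} 8^i ≤ 8^m − 1`. -/
theorem geom8_le (m : ℕ) : ∑ i : Fin m, (8:ℤ) ^ (i : ℕ) ≤ 8 ^ m - 1 := by
  induction m with
  | zero => simp
  | succ m ih =>
      rw [Fin.sum_univ_castSucc]
      simp only [Fin.val_castSucc, Fin.val_last, pow_succ]
      linarith [pow_pos (by norm_num : (0:ℤ) < 8) m]

/-! ## 2. The twin weight -/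

/-- the TWIN WEIGHT (integer valued): `2·8^p` on the block `R = {p < n+1}`, `−8^i` at the twin `n+1+i`, `4·8^{n+1}` outside. -/
def twZ (n h : ℕ) (p : Fin h) : ℤ :=
  if (p : ℕ) < n + 1 then 2 * 8 ^ (p : ℕ)
  else if (p : ℕ) < 2 * n + 2 then -(8 ^ ((p : ℕ) - (n + 1))) else 4 * 8 ^ (n + 1)

theorem twZ_rhoR (n h : ℕ) (hm : n + 1 ≤ h) (i : Fin (n + 1)) : twZ n h (rhoR n h hm i) = 2 * 8 ^ (i : ℕ) := by
  unfold twZ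
  rw [if_pos (by rw [rhoR_val]; exact i.isLt), rhoR_val]

theorem twZ_rhoR' (n h : ℕ) (hh : 2 * n + 2 ≤ h) (i : Fin (n + 1)) : twZ n h (rhoR' n h hh i) = -(8 ^ (i : ℕ)) := by
  unfold twZ
  have hi := i.isLt
  rw [if_neg (by rw [rhoR'_val]; omega), if_pos (by rw [rhoR'_val]; omega), rhoR'_val]
  congr 2
  omega

/-- block sum over `R`: `Σ_{p ∈ S, p < n+1} f p` re-indexed along `ρ`. -/
theorem sum_blockR (n h : ℕ) (hm : n + 1 ≤ h) (S : Finset (Fin h)) (f : Fin h → ℤ) :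
    ∑ p ∈ S, (if (p : ℕ) < n + 1 then f p else 0) = ∑ i : Fin (n + 1), (if rhoR n h hm i ∈ S then f (rhoR n h hm i) else 0) := by
  classical
  rw [← Finset.sum_filter, ← Finset.sum_filter]
  have hset : S.filter (fun p : Fin h => (p : ℕ) < n + 1) = (Finset.univ.filter fun i : Fin (n + 1) => rhoR n h hm i ∈ S).map (rhoR n h hm) := by
    ext p
    simp only [Finset.mem_filter, Finset.mem_map, Finset.mem_univ, true_and]
    constructor
    · rintro ⟨hp, hlt⟩
      refine ⟨⟨p, hlt⟩, ?_, ?_⟩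
      · have : rhoR n h hm ⟨p, hlt⟩ = p := Fin.ext (by simp [rhoR_val])
        rw [this]; exact hp
      · exact Fin.ext (by simp [rhoR_val])
    · rintro ⟨i, hi, rfl⟩
      exact ⟨hi, by rw [rhoR_val]; exact i.isLt⟩
  rw [hset, Finset.sum_map]

/-- block sum over the twin block `R′`: `Σ_{p ∈ S, n+1 ≤ p < 2n+2} f p` re-indexed along `ρ′`. -/
theorem sum_blockR' (n h : ℕ) (hh : 2 * n + 2 ≤ h) (S : Finset (Fin h)) (f : Fin h → ℤ) :
    ∑ p ∈ S, (if (¬ (p : ℕ) < n + 1 ∧ (p : ℕ) < 2 * n + 2) then f p else 0)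
      = ∑ i : Fin (n + 1), (if rhoR' n h hh i ∈ S then f (rhoR' n h hh i) else 0) := by
  classical
  rw [← Finset.sum_filter, ← Finset.sum_filter]
  have hset : S.filter (fun p : Fin h => ¬ (p : ℕ) < n + 1 ∧ (p : ℕ) < 2 * n + 2)
      = (Finset.univ.filter fun i : Fin (n + 1) => rhoR' n h hh i ∈ S).map (rhoR' n h hh) := by
    ext p
    simp only [Finset.mem_filter, Finset.mem_map, Finset.mem_univ, true_and]
    constructor
    · rintro ⟨hp, hge, hlt⟩
      refine ⟨⟨(p : ℕ) - (n + 1), by omega⟩, ?_, ?_⟩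
      · have : rhoR' n h hh ⟨(p : ℕ) - (n + 1), by omega⟩ = p := Fin.ext (by simp [rhoR'_val]; omega)
        rw [this]; exact hp
      · exact Fin.ext (by simp [rhoR'_val]; omega)
    · rintro ⟨i, hi, rfl⟩
      have := i.isLt
      exact ⟨hi, by rw [rhoR'_val]; omega, by rw [rhoR'_val]; omega⟩
  rw [hset, Finset.sum_map]

/-- the three-block decomposition of a twin-weight sum:
`Σ_{p∈S} v_p = Σ_i [ρ i ∈ S]·2·8^i − Σ_i [ρ′ i ∈ S]·8^i + 4·8^{n+1}·#(S ∩ outside)`. -/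
theorem sum_twZ_decomp (n h : ℕ) (hh : 2 * n + 2 ≤ h) (S : Finset (Fin h)) :
    ∑ p ∈ S, twZ n h p
      = (∑ i : Fin (n + 1), (if rhoR n h (by omega) i ∈ S then (2 * 8 ^ (i : ℕ) : ℤ) else 0))
        - (∑ i : Fin (n + 1), (if rhoR' n h hh i ∈ S then (8 ^ (i : ℕ) : ℤ) else 0))
        + 4 * 8 ^ (n + 1) * ((S.filter fun p : Fin h => ¬ (p : ℕ) < 2 * n + 2).card : ℤ) := by
  classical
  have hm : n + 1 ≤ h := by omega
  have hsplit : ∀ p : Fin h, twZ n h p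
      = (if (p : ℕ) < n + 1 then 2 * 8 ^ (p : ℕ) else 0)
        + (if (¬ (p : ℕ) < n + 1 ∧ (p : ℕ) < 2 * n + 2) then -(8 ^ ((p : ℕ) - (n + 1))) else 0)
        + (if ¬ (p : ℕ) < 2 * n + 2 then 4 * 8 ^ (n + 1) else 0) := by
    intro p
    unfold twZ
    by_cases h1 : (p : ℕ) < n + 1
    · have h2 : (p : ℕ) < 2 * n + 2 := by omega
      simp [h1, h2]
    · by_cases h2 : (p : ℕ) < 2 * n + 2
      · simp [h1, h2]
      · simp [h1, h2]
  rw [Finset.sum_congr rfl fun p _ => hsplit p, Finset.sum_add_distrib, Finset.sum_add_distrib,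
    sum_blockR n h hm S (fun p => 2 * 8 ^ (p : ℕ)), sum_blockR' n h hh S (fun p => -(8 ^ ((p : ℕ) - (n + 1))))]
  have h3 : ∑ p ∈ S, (if ¬ (p : ℕ) < 2 * n + 2 then (4 * 8 ^ (n + 1) : ℤ) else 0)
      = 4 * 8 ^ (n + 1) * ((S.filter fun p : Fin h => ¬ (p : ℕ) < 2 * n + 2).card : ℤ) := by
    rw [← Finset.sum_filter, Finset.sum_const, nsmul_eq_mul]
    ring
  have hA : ∀ i : Fin (n + 1), (if rhoR n h hm i ∈ S then (2 * 8 ^ ((rhoR n h hm i : Fin h) : ℕ) : ℤ) else 0)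
      = if rhoR n h hm i ∈ S then (2 * 8 ^ (i : ℕ) : ℤ) else 0 := by
    intro i; rw [rhoR_val]
  have hB : ∀ i : Fin (n + 1), (if rhoR' n h hh i ∈ S then (-(8 ^ (((rhoR' n h hh i : Fin h) : ℕ) - (n + 1))) : ℤ) else 0)
      = -(if rhoR' n h hh i ∈ S then (8 ^ (i : ℕ) : ℤ) else 0) := by
    intro i
    rw [rhoR'_val]
    have : n + 1 + (i : ℕ) - (n + 1) = (i : ℕ) := by omega
    rw [this]
    split_ifs <;> simp
  rw [h3, Finset.sum_congr rfl fun i _ => hA i, Finset.sum_congr rfl fun i _ => hB i, Finset.sum_neg_distrib]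
  ring

/-- every coordinate is in the block `R`, in the twin block, or outside. -/
theorem coord_trichotomy (n h : ℕ) (hh : 2 * n + 2 ≤ h) (p : Fin h) :
    (∃ i : Fin (n + 1), p = rhoR n h (by omega) i) ∨ (∃ i : Fin (n + 1), p = rhoR' n h hh i) ∨ ¬ (p : ℕ) < 2 * n + 2 := by
  by_cases h1 : (p : ℕ) < n + 1
  · exact Or.inl ⟨⟨p, h1⟩, Fin.ext (by simp [rhoR_val])⟩
  · by_cases h2 : (p : ℕ) < 2 * n + 2
    · exact Or.inr (Or.inl ⟨⟨(p : ℕ) - (n + 1), by omega⟩, Fin.ext (by simp [rhoR'_val]; omega)⟩)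
    · exact Or.inr (Or.inr h2)

/-! ## 3. Zero analysis of the twisted functional on zones -/

/-- ★ ZERO CASES.  If `V_A·(V_A + 2V_B) = 0` for the twin weight, then `A = ∅` or `B` avoids the block `R`.
(In fact then `A ⊆ R` and `B = A′`; we only need this much.) -/
theorem zone_zero_cases (n h : ℕ) (hh : 2 * n + 2 ≤ h) (A B : Finset (Fin h))
    (h0 : (∑ p ∈ A, twZ n h p) * ((∑ p ∈ A, twZ n h p) + 2 * ∑ p ∈ B, twZ n h p) = 0) :
    A = ∅ ∨ ∀ p ∈ B, ¬ (p : ℕ) < n + 1 := by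
  classical
  have hm : n + 1 ≤ h := by omega
  have hgeom := geom8_le (n + 1)
  have h8pos : (0:ℤ) < 8 ^ (n + 1) := pow_pos (by norm_num) _
  -- the digit sums are bounded by geometric sums
  have bndR : ∀ S : Finset (Fin h), 0 ≤ ∑ i : Fin (n + 1), (if rhoR n h hm i ∈ S then (2 * 8 ^ (i : ℕ) : ℤ) else 0) ∧
      ∑ i : Fin (n + 1), (if rhoR n h hm i ∈ S then (2 * 8 ^ (i : ℕ) : ℤ) else 0) ≤ 2 * (8 ^ (n + 1) - 1) := by
    intro S
    constructor
    · exact Finset.sum_nonneg fun i _ => by split_ifs <;> positivity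
    · calc ∑ i : Fin (n + 1), (if rhoR n h hm i ∈ S then (2 * 8 ^ (i : ℕ) : ℤ) else 0)
          ≤ ∑ i : Fin (n + 1), (2 * 8 ^ (i : ℕ) : ℤ) := Finset.sum_le_sum fun i _ => by
              split_ifs
              · exact le_rfl
              · positivity
        _ = 2 * ∑ i : Fin (n + 1), (8:ℤ) ^ (i : ℕ) := by rw [Finset.mul_sum]
        _ ≤ 2 * (8 ^ (n + 1) - 1) := by linarith
  have bndR' : ∀ S : Finset (Fin h), 0 ≤ ∑ i : Fin (n + 1), (if rhoR' n h hh i ∈ S then (8 ^ (i : ℕ) : ℤ) else 0) ∧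
      ∑ i : Fin (n + 1), (if rhoR' n h hh i ∈ S then (8 ^ (i : ℕ) : ℤ) else 0) ≤ 8 ^ (n + 1) - 1 := by
    intro S
    constructor
    · exact Finset.sum_nonneg fun i _ => by split_ifs <;> positivity
    · calc ∑ i : Fin (n + 1), (if rhoR' n h hh i ∈ S then (8 ^ (i : ℕ) : ℤ) else 0)
          ≤ ∑ i : Fin (n + 1), (8:ℤ) ^ (i : ℕ) := Finset.sum_le_sum fun i _ => by
              split_ifs
              · exact le_rfl
              · positivity
        _ ≤ 8 ^ (n + 1) - 1 := hgeom
  rcases mul_eq_zero.mp h0 with hA | hAB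
  · -- case `V_A = 0`: then `A = ∅`
    left
    rw [sum_twZ_decomp n h hh A] at hA
    set oA := ((A.filter fun p : Fin h => ¬ (p : ℕ) < 2 * n + 2).card : ℤ) with hoA
    have hoA0 : oA = 0 := by
      by_contra hne
      have h1 : 1 ≤ oA := by
        have : (0:ℤ) ≤ oA := by rw [hoA]; positivity
        omega
      nlinarith [(bndR A).1, (bndR' A).2, h8pos]
    rw [hoA0, mul_zero, add_zero] at hA
    -- digits `2[ρ i ∈ A] − [ρ′ i ∈ A]`
    have hdig := digits8_eq_zero (n + 1)
      (fun i => (if rhoR n h hm i ∈ A then (2:ℤ) else 0) - (if rhoR' n h hh i ∈ A then (1:ℤ) else 0))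
      (fun i => by split_ifs <;> simp)
      (by
        have e : ∑ x : Fin (n + 1), ((if rhoR n h hm x ∈ A then (2:ℤ) else 0) - (if rhoR' n h hh x ∈ A then (1:ℤ) else 0)) * 8 ^ (x : ℕ)
            = (∑ i : Fin (n + 1), (if rhoR n h hm i ∈ A then (2 * 8 ^ (i : ℕ) : ℤ) else 0))
              - (∑ i : Fin (n + 1), (if rhoR' n h hh i ∈ A then (8 ^ (i : ℕ) : ℤ) else 0)) := by
          rw [← Finset.sum_sub_distrib]
          exact Finset.sum_congr rfl fun i _ => by split_ifs <;> ring
        rw [e]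
        exact hA)
    have hcard : (A.filter fun p : Fin h => ¬ (p : ℕ) < 2 * n + 2) = ∅ := by
      apply Finset.card_eq_zero.mp
      have : (((A.filter fun p : Fin h => ¬ (p : ℕ) < 2 * n + 2).card : ℕ) : ℤ) = 0 := by rw [← hoA]; exact hoA0
      exact_mod_cast this
    apply Finset.eq_empty_of_forall_notMem
    intro p hp
    rcases coord_trichotomy n h hh p with ⟨i, rfl⟩ | ⟨i, rfl⟩ | hout
    · have key := hdig i
      rw [if_pos hp] at key
      split_ifs at key <;> norm_num at key
    · have key := hdig i
      rw [if_pos hp] at key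
      split_ifs at key <;> norm_num at key
    · have : p ∈ (A.filter fun p : Fin h => ¬ (p : ℕ) < 2 * n + 2) := Finset.mem_filter.mpr ⟨hp, hout⟩
      rw [hcard] at this
      simp at this
  · -- case `V_A + 2 V_B = 0`: then `B ∩ R = ∅`
    right
    rw [sum_twZ_decomp n h hh A, sum_twZ_decomp n h hh B] at hAB
    set oA := ((A.filter fun p : Fin h => ¬ (p : ℕ) < 2 * n + 2).card : ℤ) with hoA
    set oB := ((B.filter fun p : Fin h => ¬ (p : ℕ) < 2 * n + 2).card : ℤ) with hoB
    have ho0 : oA + 2 * oB = 0 := by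
      by_contra hne
      have hA0 : (0:ℤ) ≤ oA := by rw [hoA]; positivity
      have hB0 : (0:ℤ) ≤ oB := by rw [hoB]; positivity
      have h1 : 1 ≤ oA + 2 * oB := by omega
      nlinarith [(bndR A).1, (bndR' A).2, (bndR B).1, (bndR' B).2, h8pos]
    have hA0 : (0:ℤ) ≤ oA := by rw [hoA]; positivity
    have hB0 : (0:ℤ) ≤ oB := by rw [hoB]; positivity
    have hoA0 : oA = 0 := by omega
    have hoB0 : oB = 0 := by omega
    rw [hoA0, hoB0] at hAB
    simp only [mul_zero, add_zero] at hAB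
    -- digits `2a + 4b − a′ − 2b′`
    have hdig := digits8_eq_zero (n + 1)
      (fun i => (if rhoR n h hm i ∈ A then (2:ℤ) else 0) + (if rhoR n h hm i ∈ B then (4:ℤ) else 0)
                - (if rhoR' n h hh i ∈ A then (1:ℤ) else 0) - (if rhoR' n h hh i ∈ B then (2:ℤ) else 0))
      (fun i => by
        rw [abs_lt]
        constructor <;> split_ifs <;> norm_num)
      (by
        have e : ∑ x : Fin (n + 1), ((if rhoR n h hm x ∈ A then (2:ℤ) else 0) + (if rhoR n h hm x ∈ B then (4:ℤ) else 0)
                - (if rhoR' n h hh x ∈ A then (1:ℤ) else 0) - (if rhoR' n h hh x ∈ B then (2:ℤ) else 0)) * 8 ^ (x : ℕ)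
            = (∑ i : Fin (n + 1), (if rhoR n h hm i ∈ A then (2 * 8 ^ (i : ℕ) : ℤ) else 0))
              - (∑ i : Fin (n + 1), (if rhoR' n h hh i ∈ A then (8 ^ (i : ℕ) : ℤ) else 0))
              + 2 * ((∑ i : Fin (n + 1), (if rhoR n h hm i ∈ B then (2 * 8 ^ (i : ℕ) : ℤ) else 0))
                - (∑ i : Fin (n + 1), (if rhoR' n h hh i ∈ B then (8 ^ (i : ℕ) : ℤ) else 0))) := by
          rw [mul_sub, Finset.mul_sum, Finset.mul_sum, ← Finset.sum_sub_distrib, ← Finset.sum_sub_distrib, ← Finset.sum_add_distrib]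
          exact Finset.sum_congr rfl fun i _ => by split_ifs <;> ring
        rw [e]
        exact hAB)
    intro p hpB hlt
    have key := hdig ⟨p, hlt⟩
    have hrho : rhoR n h hm ⟨p, hlt⟩ = p := Fin.ext (by simp [rhoR_val])
    rw [hrho, if_pos hpB] at key
    split_ifs at key <;> norm_num at key

/-! ## 4. The certificate -/

/-- the twin weight as a real vector. -/
def tw (n h : ℕ) (p : Fin h) : ℝ := (twZ n h p : ℝ)

theorem sum_tw (n h : ℕ) (S : Finset (Fin h)) : ∑ p ∈ S, tw n h p = ((∑ p ∈ S, twZ n h p : ℤ) : ℝ) := by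
  unfold tw; push_cast; rfl

/-- a positive rank-one functional on a corona kernel: `(Σ_{A∪B} w)² − (Σ_B w)²`. -/
theorem rankOne_dot_coronaKernel (w : Fin h → ℝ) (A B : Finset (Fin h)) :
    (fun x : Fin h × Fin h => w x.1 * w x.2) ⬝ᵥ coronaKernel A B = (∑ p ∈ A ∪ B, w p) ^ 2 - (∑ p ∈ B, w p) ^ 2 := by
  have : (fun x : Fin h × Fin h => w x.1 * w x.2) = -(fun x : Fin h × Fin h => -(w x.1 * w x.2)) := by
    ext x; simp
  rw [this, neg_dotProduct, negRankOne_dot_coronaKernel]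
  ring

/-- the row functional `c_a = −u_a u_aᵀ + λ·v vᵀ`. -/
def cRow (n h : ℕ) (hm : n + 1 ≤ h) (lam : ℝ) (a : Finset (Fin n)) : Fin h × Fin h → ℝ :=
  (fun x : Fin h × Fin h => -(uPush (rhoR n h hm) a x.1 * uPush (rhoR n h hm) a x.2))
    + lam • (fun x : Fin h × Fin h => tw n h x.1 * tw n h x.2)

/-- the `a`-independent part `V_A (V_A + 2 V_B)` of the value of `c_a` on the zone `(A,B)`. -/
def val0 (n h : ℕ) (A B : Finset (Fin h)) : ℝ := (∑ p ∈ A, tw n h p) * ((∑ p ∈ A, tw n h p) + 2 * ∑ p ∈ B, tw n h p)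

/-- value of `c_a` on a zone: `−U_A(U_A + 2U_B) + λ·V_A(V_A + 2V_B)`. -/
theorem cRow_dot_zone (n h : ℕ) (hm : n + 1 ≤ h) (lam : ℝ) (a : Finset (Fin n)) (A B : Finset (Fin h)) (hAB : Disjoint A B) :
    cRow n h hm lam a ⬝ᵥ coronaKernel A B
      = -((∑ p ∈ A, uPush (rhoR n h hm) a p) * ((∑ p ∈ A, uPush (rhoR n h hm) a p) + 2 * ∑ p ∈ B, uPush (rhoR n h hm) a p))
        + lam * val0 n h A B := by
  rw [cRow, add_dotProduct, smul_dotProduct, smul_eq_mul, negRankOne_dot_coronaKernel, rankOne_dot_coronaKernel,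
    Finset.sum_union hAB, Finset.sum_union hAB, val0]
  ring

/-- the `u`-part is bounded: `|U_A(U_A + 2U_B)| ≤ 2(h(n+1))²` … stated as the two inequalities we use. -/
theorem uPart_abs_le (n h : ℕ) (hm : n + 1 ≤ h) (a : Finset (Fin n)) (A B : Finset (Fin h)) (hAB : Disjoint A B) :
    |(∑ p ∈ A, uPush (rhoR n h hm) a p) * ((∑ p ∈ A, uPush (rhoR n h hm) a p) + 2 * ∑ p ∈ B, uPush (rhoR n h hm) a p)|
      ≤ 2 * ((h : ℝ) * ((n : ℝ) + 1)) ^ 2 := by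
  have h1 := abs_sumU_le (rhoR n h hm) a (A ∪ B)
  have h2 := abs_sumU_le (rhoR n h hm) a B
  rw [Finset.sum_union hAB] at h1
  set UA := ∑ p ∈ A, uPush (rhoR n h hm) a p
  set UB := ∑ p ∈ B, uPush (rhoR n h hm) a p
  set M := (h : ℝ) * ((n : ℝ) + 1)
  have hM : 0 ≤ M := by positivity
  have e : UA * (UA + 2 * UB) = (UA + UB) ^ 2 - UB ^ 2 := by ring
  rw [e]
  have hsq1 : (UA + UB) ^ 2 ≤ M ^ 2 := by
    rw [← sq_abs (UA + UB)]; exact pow_le_pow_left₀ (abs_nonneg _) h1 2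
  have hsq2 : UB ^ 2 ≤ M ^ 2 := by
    rw [← sq_abs UB]; exact pow_le_pow_left₀ (abs_nonneg _) h2 2
  rw [abs_le]
  constructor <;> nlinarith [sq_nonneg (UA + UB), sq_nonneg UB]

/-- `val0` is an integer; if it is nonzero its absolute value is at least `1`. -/
theorem one_le_abs_val0 (n h : ℕ) (A B : Finset (Fin h)) (hne : val0 n h A B ≠ 0) : 1 ≤ |val0 n h A B| := by
  have hz : val0 n h A B = (((∑ p ∈ A, twZ n h p) * ((∑ p ∈ A, twZ n h p) + 2 * ∑ p ∈ B, twZ n h p) : ℤ) : ℝ) := by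
    rw [val0, sum_tw, sum_tw]; push_cast; ring
  rw [hz] at hne ⊢
  have hk : ((∑ p ∈ A, twZ n h p) * ((∑ p ∈ A, twZ n h p) + 2 * ∑ p ∈ B, twZ n h p) : ℤ) ≠ 0 := by
    intro h0; apply hne; rw [h0]; simp
  rw [← Int.cast_abs]
  exact_mod_cast Int.one_le_abs hk

/-- ★ SIGN COHERENCE.  With `λ = 2(h(n+1))² + 1`: on a zone with `val0 > 0` the row value is positive, with `val0 < 0` negative,
and with `val0 = 0` nonpositive — for EVERY row `a`. -/
theorem cRow_sign (n h : ℕ) (hh : 2 * n + 2 ≤ h) (lam : ℝ) (hlam : 2 * ((h : ℝ) * ((n : ℝ) + 1)) ^ 2 + 1 ≤ lam)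
    (a : Finset (Fin n)) (A B : Finset (Fin h)) (hAB : Disjoint A B) :
    (0 < val0 n h A B → 0 < cRow n h (by omega) lam a ⬝ᵥ coronaKernel A B) ∧
    (val0 n h A B < 0 → cRow n h (by omega) lam a ⬝ᵥ coronaKernel A B < 0) ∧
    (val0 n h A B = 0 → cRow n h (by omega) lam a ⬝ᵥ coronaKernel A B ≤ 0) := by
  have hm : n + 1 ≤ h := by omega
  have hval := cRow_dot_zone n h hm lam a A B hAB
  have hu := uPart_abs_le n h hm a A B hAB
  set UA := ∑ p ∈ A, uPush (rhoR n h hm) a p with hUA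
  set UB := ∑ p ∈ B, uPush (rhoR n h hm) a p with hUB
  set M2 := ((h : ℝ) * ((n : ℝ) + 1)) ^ 2 with hM2
  have hM2 : 0 ≤ M2 := by positivity
  rw [abs_le] at hu
  refine ⟨fun hpos => ?_, fun hneg => ?_, fun hzero => ?_⟩
  · have h1 := one_le_abs_val0 n h A B hpos.ne'
    rw [abs_of_pos hpos] at h1
    rw [hval]
    nlinarith
  · have h1 := one_le_abs_val0 n h A B hneg.ne
    rw [abs_of_neg hneg] at h1
    rw [hval]
    nlinarith
  · rw [hval, hzero, mul_zero, add_zero]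
    -- `val0 = 0`: either `A = ∅` (value `0`) or `B` avoids the block (`U_B = 0`, value `−U_A²`)
    have hz : (∑ p ∈ A, twZ n h p) * ((∑ p ∈ A, twZ n h p) + 2 * ∑ p ∈ B, twZ n h p) = 0 := by
      have : (((∑ p ∈ A, twZ n h p) * ((∑ p ∈ A, twZ n h p) + 2 * ∑ p ∈ B, twZ n h p) : ℤ) : ℝ) = 0 := by
        rw [← hzero, val0, sum_tw, sum_tw]; push_cast; ring
      exact_mod_cast this
    rcases zone_zero_cases n h hh A B hz with hA | hB
    · have : UA = 0 := by rw [hUA, hA]; simp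
      rw [this]; simp
    · have : UB = 0 := by rw [hUB]; exact sumU_offblock n h hm a B hB
      rw [this]
      nlinarith [sq_nonneg UA]

/-- the selected (mirror) zone of the pattern `b`: `val0 = 0` there. -/
theorem val0_selected (n h : ℕ) (hh : 2 * n + 2 ≤ h) (b : Finset (Fin n)) :
    val0 n h ((rootSet b).map (rhoR n h (by omega))) ((rootSet b).map (rhoR' n h hh)) = 0 := by
  have hm : n + 1 ≤ h := by omega
  rw [val0]
  have hsum : (∑ p ∈ (rootSet b).map (rhoR n h hm), tw n h p) + 2 * ∑ p ∈ (rootSet b).map (rhoR' n h hh), tw n h p = 0 := by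
    rw [Finset.sum_map, Finset.sum_map, Finset.mul_sum, ← Finset.sum_add_distrib]
    refine Finset.sum_eq_zero fun i _ => ?_
    simp only [tw]
    rw [twZ_rhoR n h hm i, twZ_rhoR' n h hh i]
    push_cast
    ring
  rw [hsum, mul_zero]

/-- the row value on the selected zone of `b`: `−(|a ∩ b| − 1)²`. -/
theorem cRow_dot_selected (n h : ℕ) (hh : 2 * n + 2 ≤ h) (lam : ℝ) (a b : Finset (Fin n)) :
    cRow n h (by omega) lam a ⬝ᵥ coronaKernel ((rootSet b).map (rhoR n h (by omega))) ((rootSet b).map (rhoR' n h hh))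
      = -((((a ∩ b).card : ℝ) - 1) ^ 2) := by
  classical
  have hm : n + 1 ≤ h := by omega
  have hAB : Disjoint ((rootSet b).map (rhoR n h hm)) ((rootSet b).map (rhoR' n h hh)) := by
    rw [Finset.disjoint_left]
    intro p hpA hpB
    obtain ⟨i, -, rfl⟩ := Finset.mem_map.mp hpA
    obtain ⟨j, -, hj⟩ := Finset.mem_map.mp hpB
    have := congrArg Fin.val hj
    simp only [rhoR'_val, rhoR_val] at this
    have := i.isLt
    omega
  rw [cRow_dot_zone n h hm lam a _ _ hAB, val0_selected n h hh b, mul_zero, add_zero]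
  have hB0 : ∑ p ∈ (rootSet b).map (rhoR' n h hh), uPush (rhoR n h hm) a p = 0 := by
    refine sumU_offblock n h hm a _ fun p hp => ?_
    obtain ⟨i, -, rfl⟩ := Finset.mem_map.mp hp
    simp only [rhoR'_val]; omega
  have hA : ∑ p ∈ (rootSet b).map (rhoR n h hm), uPush (rhoR n h hm) a p = ((a ∩ b).card : ℝ) - 1 := by
    rw [Finset.sum_map]
    have : ∀ i ∈ rootSet b, uPush (rhoR n h hm) a ((rhoR n h hm) i) = uVec a i := fun i _ => uPush_rhoR_at n h hm a i
    rw [Finset.sum_congr rfl this, rootSet, Finset.sum_filter, ← sum_uVec_chi a b]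
    refine Finset.sum_congr rfl fun i _ => ?_
    simp only [chi]
    split_ifs <;> simp
  rw [hB0, hA]
  ring

/-! ## 5. The theorem -/

/-- ★★★ MIRROR-SHATTERED CORONA ZONOTOPES ARE UNBUDGETED.  Any corona zonotope `Σ_{(A,B) ∈ F} [0,1]·g_{A,B}` on disjoint pairs whose zone family
CONTAINS the `2ⁿ` mirror pairs `(ρ(rootSet b), ρ′(rootSet b))` obeys `3ⁿ ≤ (xc + 1)·2ⁿ` — no size-matching, no condition on the other zones. -/
theorem mirror_three_pow_le (n h r : ℕ) (hh : 2 * n + 2 ≤ h) (F : Finset (Fin h) → Finset (Fin h) → Prop)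
    (hF : ∀ A B, F A B → Disjoint A B)
    (hsel : ∀ b : Finset (Fin n), F ((rootSet b).map (rhoR n h (by omega))) ((rootSet b).map (rhoR' n h hh)))
    (hEF : HasEFOfSize (zCorFam h F) r) : 3 ^ n ≤ (r + 1) * 2 ^ n := by
  classical
  have hm : n + 1 ≤ h := by omega
  set lam : ℝ := 2 * ((h : ℝ) * ((n : ℝ) + 1)) ^ 2 + 1 with hlam
  -- base point: all zones of `F` with positive twisted value
  set ind : Finset (Fin h) × Finset (Fin h) → ℝ := fun AB => if F AB.1 AB.2 ∧ 0 < val0 n h AB.1 AB.2 then 1 else 0 with hind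
  set vbase : Fin h × Fin h → ℝ := ∑ AB : Finset (Fin h) × Finset (Fin h), ind AB • coronaKernel AB.1 AB.2 with hvbase
  set sel : Finset (Fin n) → Finset (Fin h) × Finset (Fin h) :=
    fun b => ((rootSet b).map (rhoR n h hm), (rootSet b).map (rhoR' n h hh)) with hsel_def
  have hsel0 : ∀ b, ¬ (0 < val0 n h (sel b).1 (sel b).2) := fun b => by
    rw [hsel_def]; dsimp only; rw [val0_selected n h hh b]; exact lt_irrefl 0
  -- the row values dotted into the base point
  have hdot_base : ∀ a, cRow n h hm lam a ⬝ᵥ vbase = ∑ AB : Finset (Fin h) × Finset (Fin h), ind AB * (cRow n h hm lam a ⬝ᵥ coronaKernel AB.1 AB.2) := by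
    intro a
    rw [hvbase, dotProduct_sum]
    exact Finset.sum_congr rfl fun AB _ => by rw [dotProduct_smul, smul_eq_mul]
  refine hEF.three_pow_le (fun b => vbase + coronaKernel (sel b).1 (sel b).2) (fun b => ?_) (fun a => cRow n h hm lam a)
    (fun a => cRow n h hm lam a ⬝ᵥ vbase) ?_ ?_ ?_
  · -- membership: indicator of the positive zones of `F` plus the selected zone (which is not positive)
    refine ⟨fun AB => ind AB + (if AB = sel b then 1 else 0), fun AB => ?_, fun AB hAB => ?_, ?_⟩
    · rw [hind]; dsimp only
      by_cases hpos : F AB.1 AB.2 ∧ 0 < val0 n h AB.1 AB.2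
      · rw [if_pos hpos, if_neg]
        · norm_num
        · rintro rfl; exact hsel0 b hpos.2
      · rw [if_neg hpos]; split_ifs <;> norm_num
    · rw [hind]; dsimp only
      rw [if_neg (fun hc => hAB hc.1), if_neg]
      · norm_num
      · rintro rfl; exact hAB (by rw [hsel_def]; exact hsel b)
    · rw [hvbase]
      simp only [add_smul, Finset.sum_add_distrib, ite_smul, one_smul, zero_smul, Finset.sum_ite_eq', Finset.mem_univ, if_true]
  · -- validity: termwise sign coherence
    rintro a x ⟨μ, hμ, hμ0, rfl⟩
    rw [dotProduct_sum, hdot_base a]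
    refine Finset.sum_le_sum fun AB _ => ?_
    rw [dotProduct_smul, smul_eq_mul, hind]
    dsimp only
    by_cases hFAB : F AB.1 AB.2
    · have hs := cRow_sign n h hh lam le_rfl a AB.1 AB.2 (hF _ _ hFAB)
      rcases lt_trichotomy 0 (val0 n h AB.1 AB.2) with hpos | hzero | hneg
      · rw [if_pos ⟨hFAB, hpos⟩, one_mul]
        have := hs.1 hpos
        nlinarith [(hμ AB).1, (hμ AB).2]
      · have hnot : ¬ (F AB.1 AB.2 ∧ 0 < val0 n h AB.1 AB.2) := by
          rintro ⟨-, hc⟩; rw [← hzero] at hc; exact lt_irrefl _ hc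
        rw [if_neg hnot, zero_mul]
        exact mul_nonpos_of_nonneg_of_nonpos (hμ AB).1 (hs.2.2 hzero.symm)
      · rw [if_neg (fun hc => lt_asymm hneg hc.2), zero_mul]
        have := hs.2.1 hneg
        nlinarith [(hμ AB).1]
    · rw [hμ0 AB hFAB, zero_mul, if_neg (fun hc => hFAB hc.1), zero_mul]
  · -- slack pattern: `slack(a,b) = (|a ∩ b| − 1)²`, zero only if `|a ∩ b| = 1`
    intro a b hlt hcard
    rw [dotProduct_add, hsel_def] at hlt
    dsimp only at hlt
    rw [cRow_dot_selected n h hh lam a b, hcard] at hlt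
    norm_num at hlt
  · intro a b hab
    rw [dotProduct_add, hsel_def]
    dsimp only
    rw [cRow_dot_selected n h hh lam a b, Finset.disjoint_iff_inter_eq_empty.mp hab]
    norm_num

/-- ★★★ THE UNRESTRICTED CORONA ZONOTOPE `Z′_cor(h) = Σ_{A ≠ ∅, A ∩ B = ∅} [0,1]·g_{A,B}` (41's canonical covering zonotope, 44 g0's
«conjecture FAN-CHEAP») is UNBUDGETED: `3ⁿ ≤ (xc + 1)·2ⁿ` for `2n + 2 ≤ h`, i.e. `xc(Z′_cor(h)) ≥ 1.5^{⌊h/2⌋ − 1} − 1`. -/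
theorem zCorAll_three_pow_le (n h r : ℕ) (hh : 2 * n + 2 ≤ h)
    (hEF : HasEFOfSize (zCorFam h (fun A B => A.Nonempty ∧ Disjoint A B)) r) : 3 ^ n ≤ (r + 1) * 2 ^ n := by
  classical
  refine mirror_three_pow_le n h r hh _ (fun A B hAB => hAB.2) (fun b => ⟨?_, ?_⟩) hEF
  · exact ⟨rhoR n h (by omega) 0, Finset.mem_map_of_mem _ (zero_mem_rootSet b)⟩
  · rw [Finset.disjoint_left]
    intro p hpA hpB
    obtain ⟨i, -, rfl⟩ := Finset.mem_map.mp hpA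
    obtain ⟨j, -, hj⟩ := Finset.mem_map.mp hpB
    have := congrArg Fin.val hj
    simp only [rhoR'_val, rhoR_val] at this
    have := i.isLt
    omega

/-- `Z′_cor(2n+2)` has no extended formulation of size `R` once `(R+1)·2ⁿ < 3ⁿ`. -/
theorem zCorAll_not_hasEF (n R : ℕ) (hlt : (R + 1) * 2 ^ n < 3 ^ n) :
    ¬ HasEFOfSize (zCorFam (2 * n + 2) (fun A B => A.Nonempty ∧ Disjoint A B)) R := fun hEF =>
  absurd (zCorAll_three_pow_le n (2 * n + 2) R le_rfl hEF) (not_le.mpr hlt)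

/-- the size-matched theorem of 44 g0 (`zCorSM_three_pow_le`, hypothesis `2n+3 ≤ h`) re-derived from the mirror certificate — size matching was never needed. -/
theorem balanced_three_pow_le' (n h r : ℕ) (hh : 2 * n + 2 ≤ h)
    (hEF : HasEFOfSize (zCorFam h (fun A B => Disjoint A B ∧ A.card = B.card)) r) : 3 ^ n ≤ (r + 1) * 2 ^ n := by
  classical
  refine mirror_three_pow_le n h r hh _ (fun A B hAB => hAB.1) (fun b => ⟨?_, by rw [Finset.card_map, Finset.card_map]⟩) hEF
  rw [Finset.disjoint_left]
  intro p hpA hpB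
  obtain ⟨i, -, rfl⟩ := Finset.mem_map.mp hpA
  obtain ⟨j, -, hj⟩ := Finset.mem_map.mp hpB
  have := congrArg Fin.val hj
  simp only [rhoR'_val, rhoR_val] at this
  have := i.isLt
  omega

end Summit.ValiantsHypothesis.ValiantsHypothesis.Cruxes.NNDivisionHard.TwistedFace44

end
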